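import Mathlib.Data.Nat.Choose.Basic
import Mathlib.Algebra.BigOperators.Intervals
import Mathlib.Algebra.Order.BigOperators.Group.Finset
import Mathlib.Tactic
import Summits.CriticalPhenomena.PercolationContinuityZ3.Theorems.PercNearOneGluingNoHeavyLowerTailULCSmallJ
import HarnessLib

/-!
# THEOREM U-LC for shifts `j = 9, …, 12`: bases `L₀ = j² - 3` by kernel decision

Support file for the Sahi / Conjecture-P programme of route `PercNearOneGluingNoHeavy`
(`--supports stmt-CriticalPhenomena-4575`, prover prim-l12-p5 gen 28; proof note
`prim-l12-p5/U-STRUCTURE-g28.md` §3, §6).  No definitions, no named facts, no sorries.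

Sequel of `…LowerTailULCSmallJ` / `…ULCMidJ`: the two-point log-concavity of the two-bump sequence
`Φ_j^{(L)}(t) = C(L,t) + C(L,t-j)` propagates from `L` to `L+1` (`ULCSmallJ.phi_lc2_of_base`), so it holds
for all `L ≥ L₀` once checked at the base `L₀ = j² - 3` (the exact threshold: `Φ_j^{(L)}` is log-concave iff
`j² ≤ L+3`).  Here the bases for `j = 9, 10, 11, 12` (`L₀ = 78, 97, 118, 141`) are decided by the kernel, giving
THEOREM U-LC — CONJECTURE U, hence the tilted TEST(j) inequality, for all symmetric unimodal tilts —
unconditionally for every `j ≤ 12` throughout the regime `L ≥ j² - 3` (together with `ULCKappa`, `ULCTwo`,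
`ULCSmallJ`, `ULCMidJ`): `u_lc_kappa_nine` (`L ≥ 78`), `u_lc_kappa_ten` (`L ≥ 97`), `u_lc_kappa_eleven`
(`L ≥ 118`), `u_lc_kappa_twelve` (`L ≥ 141`).  (The `decide` calls need a raised `maxRecDepth`; the largest
takes ≈ 20 s of kernel time.)
-/

namespace Summit.CriticalPhenomena.PercolationContinuityZ3.Theorems

namespace ULCHighJ

open Finset

set_option maxRecDepth 400000 in
/-- Base `j = 9`, `L₀ = 78`, finite part, decided by the kernel. -/
theorem phi_lc2_nine_fin : ∀ m, m < 87 → ∀ m', m' < 87 → m ≤ m' →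
    ((78 : ℕ).choose m + (if 9 ≤ m then (78 : ℕ).choose (m - 9) else 0)) *
        ((78 : ℕ).choose (m' + 1) + (if 9 ≤ m' + 1 then (78 : ℕ).choose (m' + 1 - 9) else 0)) ≤
      ((78 : ℕ).choose (m + 1) + (if 9 ≤ m + 1 then (78 : ℕ).choose (m + 1 - 9) else 0)) *
        ((78 : ℕ).choose m' + (if 9 ≤ m' then (78 : ℕ).choose (m' - 9) else 0)) := by
  decide

/-- Base `j = 9`, `L₀ = 78`: `Φ_9^{(78)}` is two-point log-concave (over `ℕ`). -/
theorem phi_lc2_nine_base : ∀ m m', m ≤ m' →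
    ((78 : ℕ).choose m + (if 9 ≤ m then (78 : ℕ).choose (m - 9) else 0)) *
        ((78 : ℕ).choose (m' + 1) + (if 9 ≤ m' + 1 then (78 : ℕ).choose (m' + 1 - 9) else 0)) ≤
      ((78 : ℕ).choose (m + 1) + (if 9 ≤ m + 1 then (78 : ℕ).choose (m + 1 - 9) else 0)) *
        ((78 : ℕ).choose m' + (if 9 ≤ m' then (78 : ℕ).choose (m' - 9) else 0)) := by
  intro m m' hmm'
  rcases le_or_gt (78 + 9) m' with hbig | hsmall
  · exact ULCSmallJ.phi_lc2_nat_large 78 9 m m' hbig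
  · exact phi_lc2_nine_fin m (by omega) m' (by omega) hmm'

/-- `Φ_9^{(L)}` is two-point log-concave for `L ≥ 78`. -/
theorem phi_lc2_nine (L : ℕ) (hL : 78 ≤ L) (m m' : ℕ) (h : m ≤ m') :
    ((L.choose m : ℝ) + (if 9 ≤ m then (L.choose (m - 9) : ℝ) else 0)) *
        ((L.choose (m' + 1) : ℝ) + (if 9 ≤ m' + 1 then (L.choose (m' + 1 - 9) : ℝ) else 0)) ≤
      ((L.choose (m + 1) : ℝ) + (if 9 ≤ m + 1 then (L.choose (m + 1 - 9) : ℝ) else 0)) *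
        ((L.choose m' : ℝ) + (if 9 ≤ m' then (L.choose (m' - 9) : ℝ) else 0)) :=
  ULCSmallJ.phi_lc2_of_base 78 9
    (fun a b hab => ULCSmallJ.phi_lc2_real_of_nat 78 9 phi_lc2_nine_base a b hab)
    (L - 78) L (by omega) m m' h

/-- **THEOREM U-LC for `j = 9` (unconditional, `L ≥ 78`).**  With `2K + 9 = M₁+M₂+L`, `κ ≥ 0`,
`κ N(N-1) ≥ M₁M₂(N-81)` and symmetric unimodal tilts, the tilted two-block sum is nonnegative
(the tilted TEST(9) inequality). -/
theorem u_lc_kappa_nine (M₁ M₂ L K : ℕ) (hL : 78 ≤ L) (hN : 2 * K + 9 = M₁ + M₂ + L) (κ : ℝ)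
    (hκ : 0 ≤ κ)
    (hκ₀ : (M₁ : ℝ) * M₂ * (((M₁ + M₂ + L : ℕ) : ℝ) - (((M₁ + M₂ + L : ℕ) : ℝ) - 2 * K) ^ 2) ≤
      κ * (((M₁ + M₂ + L : ℕ) : ℝ) * (((M₁ + M₂ + L : ℕ) : ℝ) - 1)))
    (w₁ w₂ : ℕ → ℝ) (hw₁nn : ∀ x, 0 ≤ w₁ x)
    (hw₁sym : ∀ x, x ≤ M₁ → w₁ x = w₁ (M₁ - x)) (hw₁uni : ∀ x, 2 * x + 2 ≤ M₁ → w₁ x ≤ w₁ (x + 1))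
    (hw₂nn : ∀ x, 0 ≤ w₂ x)
    (hw₂sym : ∀ x, x ≤ M₂ → w₂ x = w₂ (M₂ - x)) (hw₂uni : ∀ x, 2 * x + 2 ≤ M₂ → w₂ x ≤ w₂ (x + 1)) :
    0 ≤ ∑ x₁ ∈ range (M₁ + 1), ∑ x₂ ∈ range (M₂ + 1),
        (M₁.choose x₁ : ℝ) * w₁ x₁ * ((M₂.choose x₂ : ℝ) * w₂ x₂) *
          (if x₁ + x₂ ≤ K then (L.choose (K - (x₁ + x₂)) : ℝ) else 0) *
          (κ + (2 * (x₁ : ℝ) - M₁) * (2 * (x₂ : ℝ) - M₂)) :=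
  ULCKappa.u_lc_kappa M₁ M₂ L K 9 hN κ hκ hκ₀ w₁ w₂ hw₁nn hw₁sym hw₁uni hw₂nn hw₂sym hw₂uni
    (fun m m' h => phi_lc2_nine L hL m m' h)

set_option maxRecDepth 400000 in
/-- Base `j = 10`, `L₀ = 97`, finite part, decided by the kernel. -/
theorem phi_lc2_ten_fin : ∀ m, m < 107 → ∀ m', m' < 107 → m ≤ m' →
    ((97 : ℕ).choose m + (if 10 ≤ m then (97 : ℕ).choose (m - 10) else 0)) *
        ((97 : ℕ).choose (m' + 1) + (if 10 ≤ m' + 1 then (97 : ℕ).choose (m' + 1 - 10) else 0)) ≤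
      ((97 : ℕ).choose (m + 1) + (if 10 ≤ m + 1 then (97 : ℕ).choose (m + 1 - 10) else 0)) *
        ((97 : ℕ).choose m' + (if 10 ≤ m' then (97 : ℕ).choose (m' - 10) else 0)) := by
  decide

/-- Base `j = 10`, `L₀ = 97`: `Φ_10^{(97)}` is two-point log-concave (over `ℕ`). -/
theorem phi_lc2_ten_base : ∀ m m', m ≤ m' →
    ((97 : ℕ).choose m + (if 10 ≤ m then (97 : ℕ).choose (m - 10) else 0)) *
        ((97 : ℕ).choose (m' + 1) + (if 10 ≤ m' + 1 then (97 : ℕ).choose (m' + 1 - 10) else 0)) ≤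
      ((97 : ℕ).choose (m + 1) + (if 10 ≤ m + 1 then (97 : ℕ).choose (m + 1 - 10) else 0)) *
        ((97 : ℕ).choose m' + (if 10 ≤ m' then (97 : ℕ).choose (m' - 10) else 0)) := by
  intro m m' hmm'
  rcases le_or_gt (97 + 10) m' with hbig | hsmall
  · exact ULCSmallJ.phi_lc2_nat_large 97 10 m m' hbig
  · exact phi_lc2_ten_fin m (by omega) m' (by omega) hmm'

/-- `Φ_10^{(L)}` is two-point log-concave for `L ≥ 97`. -/
theorem phi_lc2_ten (L : ℕ) (hL : 97 ≤ L) (m m' : ℕ) (h : m ≤ m') :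
    ((L.choose m : ℝ) + (if 10 ≤ m then (L.choose (m - 10) : ℝ) else 0)) *
        ((L.choose (m' + 1) : ℝ) + (if 10 ≤ m' + 1 then (L.choose (m' + 1 - 10) : ℝ) else 0)) ≤
      ((L.choose (m + 1) : ℝ) + (if 10 ≤ m + 1 then (L.choose (m + 1 - 10) : ℝ) else 0)) *
        ((L.choose m' : ℝ) + (if 10 ≤ m' then (L.choose (m' - 10) : ℝ) else 0)) :=
  ULCSmallJ.phi_lc2_of_base 97 10
    (fun a b hab => ULCSmallJ.phi_lc2_real_of_nat 97 10 phi_lc2_ten_base a b hab)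
    (L - 97) L (by omega) m m' h

/-- **THEOREM U-LC for `j = 10` (unconditional, `L ≥ 97`).**  With `2K + 10 = M₁+M₂+L`, `κ ≥ 0`,
`κ N(N-1) ≥ M₁M₂(N-100)` and symmetric unimodal tilts, the tilted two-block sum is nonnegative
(the tilted TEST(10) inequality). -/
theorem u_lc_kappa_ten (M₁ M₂ L K : ℕ) (hL : 97 ≤ L) (hN : 2 * K + 10 = M₁ + M₂ + L) (κ : ℝ)
    (hκ : 0 ≤ κ)
    (hκ₀ : (M₁ : ℝ) * M₂ * (((M₁ + M₂ + L : ℕ) : ℝ) - (((M₁ + M₂ + L : ℕ) : ℝ) - 2 * K) ^ 2) ≤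
      κ * (((M₁ + M₂ + L : ℕ) : ℝ) * (((M₁ + M₂ + L : ℕ) : ℝ) - 1)))
    (w₁ w₂ : ℕ → ℝ) (hw₁nn : ∀ x, 0 ≤ w₁ x)
    (hw₁sym : ∀ x, x ≤ M₁ → w₁ x = w₁ (M₁ - x)) (hw₁uni : ∀ x, 2 * x + 2 ≤ M₁ → w₁ x ≤ w₁ (x + 1))
    (hw₂nn : ∀ x, 0 ≤ w₂ x)
    (hw₂sym : ∀ x, x ≤ M₂ → w₂ x = w₂ (M₂ - x)) (hw₂uni : ∀ x, 2 * x + 2 ≤ M₂ → w₂ x ≤ w₂ (x + 1)) :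
    0 ≤ ∑ x₁ ∈ range (M₁ + 1), ∑ x₂ ∈ range (M₂ + 1),
        (M₁.choose x₁ : ℝ) * w₁ x₁ * ((M₂.choose x₂ : ℝ) * w₂ x₂) *
          (if x₁ + x₂ ≤ K then (L.choose (K - (x₁ + x₂)) : ℝ) else 0) *
          (κ + (2 * (x₁ : ℝ) - M₁) * (2 * (x₂ : ℝ) - M₂)) :=
  ULCKappa.u_lc_kappa M₁ M₂ L K 10 hN κ hκ hκ₀ w₁ w₂ hw₁nn hw₁sym hw₁uni hw₂nn hw₂sym hw₂uni
    (fun m m' h => phi_lc2_ten L hL m m' h)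

set_option maxRecDepth 400000 in
/-- Base `j = 11`, `L₀ = 118`, finite part, decided by the kernel. -/
theorem phi_lc2_eleven_fin : ∀ m, m < 129 → ∀ m', m' < 129 → m ≤ m' →
    ((118 : ℕ).choose m + (if 11 ≤ m then (118 : ℕ).choose (m - 11) else 0)) *
        ((118 : ℕ).choose (m' + 1) + (if 11 ≤ m' + 1 then (118 : ℕ).choose (m' + 1 - 11) else 0)) ≤
      ((118 : ℕ).choose (m + 1) + (if 11 ≤ m + 1 then (118 : ℕ).choose (m + 1 - 11) else 0)) *
        ((118 : ℕ).choose m' + (if 11 ≤ m' then (118 : ℕ).choose (m' - 11) else 0)) := by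
  decide

/-- Base `j = 11`, `L₀ = 118`: `Φ_11^{(118)}` is two-point log-concave (over `ℕ`). -/
theorem phi_lc2_eleven_base : ∀ m m', m ≤ m' →
    ((118 : ℕ).choose m + (if 11 ≤ m then (118 : ℕ).choose (m - 11) else 0)) *
        ((118 : ℕ).choose (m' + 1) + (if 11 ≤ m' + 1 then (118 : ℕ).choose (m' + 1 - 11) else 0)) ≤
      ((118 : ℕ).choose (m + 1) + (if 11 ≤ m + 1 then (118 : ℕ).choose (m + 1 - 11) else 0)) *
        ((118 : ℕ).choose m' + (if 11 ≤ m' then (118 : ℕ).choose (m' - 11) else 0)) := by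
  intro m m' hmm'
  rcases le_or_gt (118 + 11) m' with hbig | hsmall
  · exact ULCSmallJ.phi_lc2_nat_large 118 11 m m' hbig
  · exact phi_lc2_eleven_fin m (by omega) m' (by omega) hmm'

/-- `Φ_11^{(L)}` is two-point log-concave for `L ≥ 118`. -/
theorem phi_lc2_eleven (L : ℕ) (hL : 118 ≤ L) (m m' : ℕ) (h : m ≤ m') :
    ((L.choose m : ℝ) + (if 11 ≤ m then (L.choose (m - 11) : ℝ) else 0)) *
        ((L.choose (m' + 1) : ℝ) + (if 11 ≤ m' + 1 then (L.choose (m' + 1 - 11) : ℝ) else 0)) ≤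
      ((L.choose (m + 1) : ℝ) + (if 11 ≤ m + 1 then (L.choose (m + 1 - 11) : ℝ) else 0)) *
        ((L.choose m' : ℝ) + (if 11 ≤ m' then (L.choose (m' - 11) : ℝ) else 0)) :=
  ULCSmallJ.phi_lc2_of_base 118 11
    (fun a b hab => ULCSmallJ.phi_lc2_real_of_nat 118 11 phi_lc2_eleven_base a b hab)
    (L - 118) L (by omega) m m' h

/-- **THEOREM U-LC for `j = 11` (unconditional, `L ≥ 118`).**  With `2K + 11 = M₁+M₂+L`, `κ ≥ 0`,
`κ N(N-1) ≥ M₁M₂(N-121)` and symmetric unimodal tilts, the tilted two-block sum is nonnegative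
(the tilted TEST(11) inequality). -/
theorem u_lc_kappa_eleven (M₁ M₂ L K : ℕ) (hL : 118 ≤ L) (hN : 2 * K + 11 = M₁ + M₂ + L) (κ : ℝ)
    (hκ : 0 ≤ κ)
    (hκ₀ : (M₁ : ℝ) * M₂ * (((M₁ + M₂ + L : ℕ) : ℝ) - (((M₁ + M₂ + L : ℕ) : ℝ) - 2 * K) ^ 2) ≤
      κ * (((M₁ + M₂ + L : ℕ) : ℝ) * (((M₁ + M₂ + L : ℕ) : ℝ) - 1)))
    (w₁ w₂ : ℕ → ℝ) (hw₁nn : ∀ x, 0 ≤ w₁ x)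
    (hw₁sym : ∀ x, x ≤ M₁ → w₁ x = w₁ (M₁ - x)) (hw₁uni : ∀ x, 2 * x + 2 ≤ M₁ → w₁ x ≤ w₁ (x + 1))
    (hw₂nn : ∀ x, 0 ≤ w₂ x)
    (hw₂sym : ∀ x, x ≤ M₂ → w₂ x = w₂ (M₂ - x)) (hw₂uni : ∀ x, 2 * x + 2 ≤ M₂ → w₂ x ≤ w₂ (x + 1)) :
    0 ≤ ∑ x₁ ∈ range (M₁ + 1), ∑ x₂ ∈ range (M₂ + 1),
        (M₁.choose x₁ : ℝ) * w₁ x₁ * ((M₂.choose x₂ : ℝ) * w₂ x₂) *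
          (if x₁ + x₂ ≤ K then (L.choose (K - (x₁ + x₂)) : ℝ) else 0) *
          (κ + (2 * (x₁ : ℝ) - M₁) * (2 * (x₂ : ℝ) - M₂)) :=
  ULCKappa.u_lc_kappa M₁ M₂ L K 11 hN κ hκ hκ₀ w₁ w₂ hw₁nn hw₁sym hw₁uni hw₂nn hw₂sym hw₂uni
    (fun m m' h => phi_lc2_eleven L hL m m' h)

set_option maxRecDepth 400000 in
/-- Base `j = 12`, `L₀ = 141`, finite part, decided by the kernel. -/
theorem phi_lc2_twelve_fin : ∀ m, m < 153 → ∀ m', m' < 153 → m ≤ m' →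
    ((141 : ℕ).choose m + (if 12 ≤ m then (141 : ℕ).choose (m - 12) else 0)) *
        ((141 : ℕ).choose (m' + 1) + (if 12 ≤ m' + 1 then (141 : ℕ).choose (m' + 1 - 12) else 0)) ≤
      ((141 : ℕ).choose (m + 1) + (if 12 ≤ m + 1 then (141 : ℕ).choose (m + 1 - 12) else 0)) *
        ((141 : ℕ).choose m' + (if 12 ≤ m' then (141 : ℕ).choose (m' - 12) else 0)) := by
  decide

/-- Base `j = 12`, `L₀ = 141`: `Φ_12^{(141)}` is two-point log-concave (over `ℕ`). -/
theorem phi_lc2_twelve_base : ∀ m m', m ≤ m' →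
    ((141 : ℕ).choose m + (if 12 ≤ m then (141 : ℕ).choose (m - 12) else 0)) *
        ((141 : ℕ).choose (m' + 1) + (if 12 ≤ m' + 1 then (141 : ℕ).choose (m' + 1 - 12) else 0)) ≤
      ((141 : ℕ).choose (m + 1) + (if 12 ≤ m + 1 then (141 : ℕ).choose (m + 1 - 12) else 0)) *
        ((141 : ℕ).choose m' + (if 12 ≤ m' then (141 : ℕ).choose (m' - 12) else 0)) := by
  intro m m' hmm'
  rcases le_or_gt (141 + 12) m' with hbig | hsmall
  · exact ULCSmallJ.phi_lc2_nat_large 141 12 m m' hbig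
  · exact phi_lc2_twelve_fin m (by omega) m' (by omega) hmm'

/-- `Φ_12^{(L)}` is two-point log-concave for `L ≥ 141`. -/
theorem phi_lc2_twelve (L : ℕ) (hL : 141 ≤ L) (m m' : ℕ) (h : m ≤ m') :
    ((L.choose m : ℝ) + (if 12 ≤ m then (L.choose (m - 12) : ℝ) else 0)) *
        ((L.choose (m' + 1) : ℝ) + (if 12 ≤ m' + 1 then (L.choose (m' + 1 - 12) : ℝ) else 0)) ≤
      ((L.choose (m + 1) : ℝ) + (if 12 ≤ m + 1 then (L.choose (m + 1 - 12) : ℝ) else 0)) *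
        ((L.choose m' : ℝ) + (if 12 ≤ m' then (L.choose (m' - 12) : ℝ) else 0)) :=
  ULCSmallJ.phi_lc2_of_base 141 12
    (fun a b hab => ULCSmallJ.phi_lc2_real_of_nat 141 12 phi_lc2_twelve_base a b hab)
    (L - 141) L (by omega) m m' h

/-- **THEOREM U-LC for `j = 12` (unconditional, `L ≥ 141`).**  With `2K + 12 = M₁+M₂+L`, `κ ≥ 0`,
`κ N(N-1) ≥ M₁M₂(N-144)` and symmetric unimodal tilts, the tilted two-block sum is nonnegative
(the tilted TEST(12) inequality). -/
theorem u_lc_kappa_twelve (M₁ M₂ L K : ℕ) (hL : 141 ≤ L) (hN : 2 * K + 12 = M₁ + M₂ + L) (κ : ℝ)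
    (hκ : 0 ≤ κ)
    (hκ₀ : (M₁ : ℝ) * M₂ * (((M₁ + M₂ + L : ℕ) : ℝ) - (((M₁ + M₂ + L : ℕ) : ℝ) - 2 * K) ^ 2) ≤
      κ * (((M₁ + M₂ + L : ℕ) : ℝ) * (((M₁ + M₂ + L : ℕ) : ℝ) - 1)))
    (w₁ w₂ : ℕ → ℝ) (hw₁nn : ∀ x, 0 ≤ w₁ x)
    (hw₁sym : ∀ x, x ≤ M₁ → w₁ x = w₁ (M₁ - x)) (hw₁uni : ∀ x, 2 * x + 2 ≤ M₁ → w₁ x ≤ w₁ (x + 1))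
    (hw₂nn : ∀ x, 0 ≤ w₂ x)
    (hw₂sym : ∀ x, x ≤ M₂ → w₂ x = w₂ (M₂ - x)) (hw₂uni : ∀ x, 2 * x + 2 ≤ M₂ → w₂ x ≤ w₂ (x + 1)) :
    0 ≤ ∑ x₁ ∈ range (M₁ + 1), ∑ x₂ ∈ range (M₂ + 1),
        (M₁.choose x₁ : ℝ) * w₁ x₁ * ((M₂.choose x₂ : ℝ) * w₂ x₂) *
          (if x₁ + x₂ ≤ K then (L.choose (K - (x₁ + x₂)) : ℝ) else 0) *
          (κ + (2 * (x₁ : ℝ) - M₁) * (2 * (x₂ : ℝ) - M₂)) :=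
  ULCKappa.u_lc_kappa M₁ M₂ L K 12 hN κ hκ hκ₀ w₁ w₂ hw₁nn hw₁sym hw₁uni hw₂nn hw₂sym hw₂uni
    (fun m m' h => phi_lc2_twelve L hL m m' h)

end ULCHighJ

end Summit.CriticalPhenomena.PercolationContinuityZ3.Theorems
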